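import Summits.CriticalPhenomena.CardyFormulaZ2.Theorems.CardyComplexConeParafermionToSLESixFamiliesDiamondDefs
import HarnessLib

/-!
# Line `potential-darboux-picard-diamond`, stub S4 (`stub_identifyPotential`): all exact pairs of one datum differ by constants

Helper file of the stub `stub_identifyPotential` of crux `ParafermionToSLESixFamilies` (stmt-CriticalPhenomena-11389).
The uniform clause of `PotentialConformalLimit` is quantified over ALL exact potential pairs `(Φ, Ψ)` of the datum
`Λ (u (s k))`, whereas the limit `G` is built from ONE chosen sequence of pairs. This file bridges the two using only clause
(a) of `ClosedPrecompactness` (S3) at a fixed mesh: exact pairs form an affine space (`isExactPair_lineThrough`), so a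
bound valid for every exact pair forces the difference of two exact pairs to be CONSTANT on `η`-close cells
(`exactPair_sub_eq_of_forall_bound`, registered helper of the crux item); chaining over the `η`-dense cells of the diamond
then makes it constant on all cells. Also recorded: the passage from `∀ᶠ δ in 𝓝[>] 0` to `∀ᶠ k` along a positive mesh
sequence `u_k → 0` (`eventually_atTop_of_eventually_nhdsGT`), used for the first conjunct of `PotentialConformalLimit`.
-/

noncomputable section

namespace Summit.CriticalPhenomena.CardyFormulaZ2.Cruxes.ParafermionToSLESixFamilies.PotentialDarbouxPicardDiamond

open scoped Topology
open Filter Set Metric Complex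
open Literature.Probability.LatticeModels

/-- Along a sequence of positive meshes `u_k → 0`, a property holding for all small positive meshes holds for all large
`k`. -/
theorem eventually_atTop_of_eventually_nhdsGT {P : ℝ → Prop} {u : ℕ → ℝ} (hu : ∀ k, 0 < u k)
    (hu0 : Tendsto u atTop (𝓝 0)) (h : ∀ᶠ δ in 𝓝[>] (0:ℝ), P δ) : ∀ᶠ k in atTop, P (u k) := by
  have ht : Tendsto u atTop (𝓝[>] (0:ℝ)) :=
    tendsto_nhdsWithin_iff.2 ⟨hu0, Eventually.of_forall fun k => hu k⟩
  exact ht.eventually h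

/-- Exact pairs of a datum form an affine space: the line through two exact pairs consists of exact pairs. -/
theorem isExactPair_lineThrough {E : DiscreteDobrushin} {δ : ℝ} {Φ₁ Ψ₁ Φ₂ Ψ₂ : Site 2 → ℂ}
    (h₁ : IsExactPair E δ Φ₁ Ψ₁) (h₂ : IsExactPair E δ Φ₂ Ψ₂) (t : ℂ) :
    IsExactPair E δ (fun v => Φ₁ v + t * (Φ₂ v - Φ₁ v)) (fun f => Ψ₁ f + t * (Ψ₂ f - Ψ₁ f)) := by
  intro v f hc hf hA hB
  have e₁ := h₁ v f hc hf hA hB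
  have e₂ := h₂ v f hc hf hA hB
  linear_combination e₁ + t * (e₂ - e₁)

/-- **Two exact pairs differ by a constant on `η`-close cells.** If, at a fixed datum and mesh `δ > 0`, EVERY exact pair
`(Φ, Ψ)` satisfies `‖δ^{2/3}(Ψ f − Ψ f')‖ ≤ ε` for all cells `f, f'` with centres closer than `η` (clause (a) of
`ClosedPrecompactness` at that mesh), then for any two exact pairs the difference `Ψ₂ − Ψ₁` takes the same value on any
two such cells (apply the bound along the line through the two pairs and let the parameter tend to infinity). -/
theorem exactPair_sub_eq_of_forall_bound : ∀ (E : DiscreteDobrushin) (δ ε η : ℝ), 0 < δ → (∀ Φ Ψ : Site 2 → ℂ, IsExactPair E δ Φ Ψ → ∀ f f' : Site 2, IsCell E f → IsCell E f' → dist (ctr δ f) (ctr δ f') < η → ‖(((δ ^ ((2:ℝ) / 3) : ℝ) : ℂ)) * (Ψ f - Ψ f')‖ ≤ ε) → ∀ Φ₁ Ψ₁ Φ₂ Ψ₂ : Site 2 → ℂ, IsExactPair E δ Φ₁ Ψ₁ → IsExactPair E δ Φ₂ Ψ₂ → ∀ f f' : Site 2, IsCell E f → IsCell E f' → dist (ctr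 δ f) (ctr δ f') < η → Ψ₂ f - Ψ₁ f = Ψ₂ f' - Ψ₁ f' := by
  intro E δ ε η hδ hbd Φ₁ Ψ₁ Φ₂ Ψ₂ h₁ h₂ f f' hf hf' hdist
  by_contra hne
  set c : ℂ := ((δ ^ ((2:ℝ) / 3) : ℝ) : ℂ) with hc
  set a : ℂ := c * (Ψ₁ f - Ψ₁ f') with ha
  set b : ℂ := c * ((Ψ₂ f - Ψ₁ f) - (Ψ₂ f' - Ψ₁ f')) with hb
  have hcpos : 0 < δ ^ ((2:ℝ) / 3) := Real.rpow_pos_of_pos hδ _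
  have hc0 : c ≠ 0 := by rw [hc]; exact_mod_cast hcpos.ne'
  have hb0 : b ≠ 0 := mul_ne_zero hc0 (sub_ne_zero.2 hne)
  have hbpos : 0 < ‖b‖ := norm_pos_iff.2 hb0
  -- the bound along the line through the two pairs: `‖a + t b‖ ≤ ε` for every real `t`
  have hline : ∀ t : ℝ, ‖a + t * b‖ ≤ ε := by
    intro t
    have h := hbd _ _ (isExactPair_lineThrough h₁ h₂ t) f f' hf hf' hdist
    have : c * (Ψ₁ f + t * (Ψ₂ f - Ψ₁ f) - (Ψ₁ f' + t * (Ψ₂ f' - Ψ₁ f'))) = a + t * b := by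
      simp only [ha, hb]; ring
    rwa [this] at h
  have hε : 0 ≤ ε := (norm_nonneg _).trans (hline 0)
  -- but `t ↦ ‖a + t b‖` is unbounded
  set t : ℝ := (ε + ‖a‖ + 1) / ‖b‖ with ht
  have h1 := hline t
  have h2 : ‖(t : ℂ) * b‖ ≤ ‖a + t * b‖ + ‖a‖ := by
    have := norm_sub_le (a + t * b) a
    rwa [add_sub_cancel_left] at this
  have h3 : ‖(t : ℂ) * b‖ = ε + ‖a‖ + 1 := by
    rw [norm_mul, norm_real, Real.norm_eq_abs, ht, abs_of_nonneg (by positivity), div_mul_cancel₀ _ hbpos.ne']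
  linarith

end Summit.CriticalPhenomena.CardyFormulaZ2.Cruxes.ParafermionToSLESixFamilies.PotentialDarbouxPicardDiamond

end
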